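import Summits.ResolutionOfSingularities.ResolutionOfSingularities.Theorems.PAlterationAssembly
import Summits.ResolutionOfSingularities.ResolutionOfSingularities.Theses.WildQuotients
import HarnessLib

/-!
# Card `perfect-squeeze` — the PROVED perfect-field frame for `WildQuotients.SummitReduction`
# (stmt-ResolutionOfSingularities-16324), crux-ideate round 1, ideator k = 1

Binder surgery on pAlteration's proved per-prime frame: the hypothesis (PIAlt_p) is only ever
consumed over PERFECT fields (Theorem A, Step 1, applied at `K = PerfectClosure k p`), so the four
theorems `hasResolution_of_pialt_picover_perfectField` → `exists_resolution_perfectClosure` →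
`exists_level_model` → `hasResolution_of_thesis` are re-proved VERBATIM (proof scripts copied
unchanged from `Theorems/PAlterationAssembly{Perfect,PerfectBase,LevelModel,}.lean`) with the
extra binder `[PerfectField k]` in `hPI`. Consequences at the end of the file:

* `resolutionInChar_of_pialtPerfect_picover` : `PIAlt_p^perf → PICover_p → ResolutionInChar p`;
* `summitReduction_of_galoisReductionPerfect` :
    `(∀ p prime, WQ_p^perf → PIAlt_p^perf) → WildQuotients.SummitReduction` (by name).

So the crux's de Jong content is owed over PERFECT ground fields only, and it consumes
`WildQuotientResolution` over perfect fields only.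
-/

set_option linter.dupNamespace false

noncomputable section

open CategoryTheory CategoryTheory.Limits AlgebraicGeometry TopologicalSpace Topology

open Literature.AlgebraicGeometry.Resolution Literature.AlgebraicGeometry.Motives Scheme.IdealSheafData

namespace Summit.ResolutionOfSingularities.ResolutionOfSingularities.Theorems

/-! ## Theorem A with perfect-field (PIAlt) (copy of `hasResolution_of_pialt_picover_perfectField`) -/


/-- **Theorem A.** For a prime `p`, the conjunction of (PIAlt_p) — purely inseparable regular
alterations of integral varieties over fields of characteristic `p` — and (PICover_p) —
resolution of finite radicial covers of regular varieties over fields of characteristic `p` —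
implies resolution of singularities for every integral separated scheme of finite type over a
PERFECT field of characteristic `p` (Frobenius pull-back of the alteration; see the module
docstring). [folklore] -/
theorem hasResolution_of_pialtPerfect_picover_perfectField (p : ℕ) (hp : p.Prime)
    (hPI : ∀ (k : Type) [Field k] [CharP k p] [PerfectField k] (X : Scheme.{0}) (f : X ⟶ Spec (.of k)),
      IsSeparated f → LocallyOfFiniteType f → QuasiCompact f → IsIntegral X →
      ∃ (X' : Scheme.{0}) (g : X' ⟶ X), IsProper g ∧ IsIntegral X' ∧ Scheme.IsRegular X' ∧
        Function.Surjective g.base ∧ ∃ U : X.Opens, Dense (U : Set X) ∧ IsFinite (g ∣_ U) ∧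
        UniversallyInjective (g ∣_ U))
    (hPC : ∀ (k : Type) [Field k] [CharP k p] (Y X : Scheme.{0}) (f : Y ⟶ Spec (.of k))
      (g : X ⟶ Y), IsSeparated f → LocallyOfFiniteType f → QuasiCompact f → IsIntegral Y →
      Scheme.IsRegular Y → IsIntegral X → IsFinite g → UniversallyInjective g →
      Function.Surjective g.base → Scheme.HasResolution X)
    (K : Type) [Field K] [CharP K p] [PerfectField K] (X : Scheme.{0}) (f : X ⟶ Spec (.of K))
    [IsSeparated f] [LocallyOfFiniteType f] [QuasiCompact f] [IsIntegral X] :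
    Scheme.HasResolution X := by
  haveI : Fact p.Prime := ⟨hp⟩
  -- Step 0: we may assume `X` normal
  wlog hnorm : ∀ x : X, IsIntegrallyClosed (X.presheaf.stalk x) generalizing X
  · haveI hfinν := isFinite_normalizationι X NoetherFiniteIntegralClosure_holds f
    refine Scheme.HasResolution.of_normalization X f ?_
    exact this (normalization X) (normalizationι X ≫ f) (isIntegrallyClosed_stalk_normalization X)
  -- Step 1: the purely inseparable regular alteration
  obtain ⟨X', g, hgP, hX'int, hX'reg, hgsurj, U, hUd, hgfin, hgui⟩ :=
    hPI K X f ‹_› ‹_› ‹_› ‹_›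
  haveI := hgP
  haveI := hX'int
  haveI : Surjective g := ⟨hgsurj⟩
  -- Step 2: a non-empty affine open `W ⊆ U`
  obtain ⟨x₀⟩ := (inferInstance : Nonempty X)
  obtain ⟨u, hu⟩ := hUd.nonempty
  obtain ⟨W, hW, huW, hWU⟩ : ∃ W : X.Opens, W ∈ X.affineOpens ∧ u ∈ W ∧ W ≤ U :=
    Opens.isBasis_iff_nbhd.mp X.isBasis_affineOpens hu
  haveI hgWfin : IsFinite (g ∣_ W) := restrict_of_le g hWU hgfin
  haveI hgWui : UniversallyInjective (g ∣_ W) := restrict_of_le g hWU hgui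
  haveI : Nonempty W := ⟨⟨u, huW⟩⟩
  haveI : IsIntegral (W : Scheme.{0}) := isIntegral_of_isOpenImmersion W.ι
  obtain ⟨x', hx'⟩ := hgsurj u
  haveI : Nonempty (g ⁻¹ᵁ W) := ⟨⟨x', show g.base x' ∈ W by rw [hx']; exact huW⟩⟩
  haveI : IsIntegral (g ⁻¹ᵁ W : Scheme.{0}) := isIntegral_of_isOpenImmersion (g ⁻¹ᵁ W).ι
  haveI : Surjective (g ∣_ W) := IsZariskiLocalAtTarget.restrict ‹Surjective g› W
  haveI : IsAffine W := hW
  -- characteristic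
  have hpX : (p : Γ(X, ⊤)) = 0 := natCast_appTop_eq_zero p f
  have hpW : (p : Γ((W : Scheme.{0}), ⊤)) = 0 := by
    rw [← map_natCast W.ι.appTop.hom p, hpX, map_zero]
  -- Step 3: the Frobenius factor over `W`
  haveI : Nonempty ((g ∣_ W) ⁻¹ᵁ (⊤ : (W : Scheme.{0}).Opens)) :=
    ⟨⟨Classical.arbitrary _, trivial⟩⟩
  haveI : Nonempty (⊤ : (W : Scheme.{0}).Opens) := ⟨⟨Classical.arbitrary _, trivial⟩⟩
  obtain ⟨N, σ, hσ1, hσ2⟩ := exists_frobeniusFactor_app (g ∣_ W)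
    (isIntegrallyClosed_stalk_opens W hnorm) p hpW ⊤ (isAffineOpen_top _)
  -- Step 4: the finite Frobenius power `F`
  have hadd := add_pow_sections p hpX N
  set F := powEndo X (p ^ N) (pow_ne_zero N hp.ne_zero) hadd with hFdef
  haveI : IsFinite F := isFinite_powEndo p f N hadd
  haveI : UniversallyInjective F := universallyInjective_powEndo X p N hadd hpX
  haveI : Surjective F := ⟨fun x => ⟨x, rfl⟩⟩
  -- Step 5: the reduced Frobenius pull-back `Z` and its resolution from (PICover)
  set Z := (vanishingIdeal (⊤ : Closeds ↑(pullback F g))).subscheme with hZdef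
  set ι := (vanishingIdeal (⊤ : Closeds ↑(pullback F g))).subschemeι with hιdef
  haveI : IsIntegral Z := isIntegral_reduced_pullback F g
  have hZres : Scheme.HasResolution Z :=
    hPC K X' Z (g ≫ f) (ι ≫ pullback.snd F g) inferInstance inferInstance inferInstance hX'int
      hX'reg inferInstance (isFinite_reduced_pullback_snd F g)
      (universallyInjective_reduced_pullback_snd F g) (surjective_reduced_pullback_snd F g).1
  -- Step 6: `π : Z → X` is proper and birational
  set π := ι ≫ pullback.fst F g with hπdef
  haveI : IsProper π := inferInstance
  refine Scheme.HasResolution.of_isBirational π ⟨W, W.2.dense ⟨u, huW⟩, ?_, ?_⟩ hZres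
  · -- `π⁻¹ W` is a non-empty open of the irreducible `Z`
    refine (π ⁻¹ᵁ W).2.dense ?_
    obtain ⟨z, hz⟩ := (inferInstance : Surjective π).1 u
    exact ⟨z, show π.base z ∈ W by rw [hz]; exact huW⟩
  -- `π` is injective over `W`
  have hmem : ∀ c : ↥(π ⁻¹ᵁ W), g.base ((pullback.snd F g).base (ι.base c.1)) ∈ W := by
    intro c
    rw [← Scheme.Hom.comp_apply, ← pullback.condition, Scheme.Hom.comp_apply]
    exact c.2
  have hinj : Function.Injective (π ∣_ W).base := by
    intro a b hab
    have h1 : π.base a.1 = π.base b.1 := by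
      have := congrArg Subtype.val hab
      rwa [morphismRestrict_base_coe, morphismRestrict_base_coe] at this
    have h3 : (pullback.snd F g).base (ι.base a.1) = (pullback.snd F g).base (ι.base b.1) := by
      have key : (g ∣_ W).base ⟨_, hmem a⟩ = (g ∣_ W).base ⟨_, hmem b⟩ := by
        apply Subtype.ext
        rw [morphismRestrict_base_coe, morphismRestrict_base_coe]
        change (pullback.snd F g ≫ g).base (ι.base a.1) = (pullback.snd F g ≫ g).base (ι.base b.1)
        rw [← pullback.condition]
        exact h1
      exact congrArg Subtype.val ((g ∣_ W).injective key)
    exact Subtype.ext (ι.isClosedEmbedding.injective ((pullback.snd F g).injective h3))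
  -- the section over `W`: first `b₀ : W → g⁻¹ W`, `Spec` of the Frobenius factor `σ`
  haveI : IsAffine (g ⁻¹ᵁ W : Scheme.{0}) := isAffine_of_isAffineHom (g ∣_ W)
  obtain ⟨σ', -, hσ2'⟩ : ∃ σ' : Γ((g ⁻¹ᵁ W : Scheme.{0}), ⊤) →+* Γ((W : Scheme.{0}), ⊤),
      (∀ c, (g ∣_ W).appTop (σ' c) = c ^ p ^ N) ∧ ∀ a, σ' ((g ∣_ W).appTop a) = a ^ p ^ N :=
    ⟨σ, hσ1, hσ2⟩
  have haddW := add_pow_sections p hpW N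
  have hpS : (p : Γ(Spec Γ((W : Scheme.{0}), ⊤), ⊤)) = 0 :=
    natCast_appTop_eq_zero p ((W : Scheme.{0}).isoSpec.inv ≫ W.ι ≫ f)
  have haddS := add_pow_sections p hpS N
  let τ : Γ((g ⁻¹ᵁ W : Scheme.{0}), ⊤) ⟶ Γ((W : Scheme.{0}), ⊤) := CommRingCat.ofHom σ'
  have e1 : (g ∣_ W).appTop ≫ τ = CommRingCat.ofHom (powRingHom Γ((W : Scheme.{0}), ⊤) (p ^ N)
      (pow_ne_zero N hp.ne_zero) (haddW ⊤)) := by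
    ext a
    simp only [τ, CommRingCat.hom_comp, CommRingCat.hom_ofHom, RingHom.comp_apply, powRingHom_apply]
    exact hσ2' a
  let b₀ : (W : Scheme.{0}) ⟶ (g ⁻¹ᵁ W : Scheme.{0}) :=
    (W : Scheme.{0}).isoSpec.hom ≫ Spec.map τ ≫ (g ⁻¹ᵁ W : Scheme.{0}).isoSpec.inv
  have hb₀ : b₀ ≫ (g ∣_ W) = powEndo (W : Scheme.{0}) (p ^ N) (pow_ne_zero N hp.ne_zero) haddW := by
    have h1 : (g ⁻¹ᵁ W : Scheme.{0}).isoSpec.inv ≫ (g ∣_ W) =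
        Spec.map (g ∣_ W).appTop ≫ (W : Scheme.{0}).isoSpec.inv :=
      (Scheme.isoSpec_inv_naturality _).symm
    have h3 : Spec.map (CommRingCat.ofHom (powRingHom Γ((W : Scheme.{0}), ⊤) (p ^ N)
        (pow_ne_zero N hp.ne_zero) (haddW ⊤))) =
        powEndo (Spec Γ((W : Scheme.{0}), ⊤)) (p ^ N) (pow_ne_zero N hp.ne_zero) haddS :=
      (powEndo_Spec (p ^ N) (pow_ne_zero N hp.ne_zero) (Γ((W : Scheme.{0}), ⊤)) (haddW ⊤) haddS).symm
    have h2 : Spec.map τ ≫ Spec.map (g ∣_ W).appTop =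
        powEndo (Spec Γ((W : Scheme.{0}), ⊤)) (p ^ N) (pow_ne_zero N hp.ne_zero) haddS := by
      rw [← Spec.map_comp, e1, h3]
    have h4 : (W : Scheme.{0}).isoSpec.hom ≫
        powEndo (Spec Γ((W : Scheme.{0}), ⊤)) (p ^ N) (pow_ne_zero N hp.ne_zero) haddS =
        powEndo (W : Scheme.{0}) (p ^ N) (pow_ne_zero N hp.ne_zero) haddW ≫ (W : Scheme.{0}).isoSpec.hom :=
      (powEndo_comp (p ^ N) (pow_ne_zero N hp.ne_zero) haddW _ haddS).symm
    simp only [b₀, Category.assoc]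
    rw [h1, ← Category.assoc (Spec.map τ), h2, ← Category.assoc, h4, Category.assoc, Iso.hom_inv_id,
      Category.comp_id]
  -- the point of the pull-back over `W`
  have hw : W.ι ≫ F = (b₀ ≫ (g ⁻¹ᵁ W).ι) ≫ g := by
    rw [Category.assoc, ← morphismRestrict_ι, ← Category.assoc, hb₀, hFdef,
      powEndo_comp (p ^ N) (pow_ne_zero N hp.ne_zero) haddW W.ι hadd]
  obtain ⟨s₁, hs₁⟩ := exists_lift_reduced (pullback.lift W.ι (b₀ ≫ (g ⁻¹ᵁ W).ι) hw)
  have hs₁π : s₁ ≫ π = W.ι := by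
    rw [hπdef, ← Category.assoc, hιdef, hs₁, pullback.lift_fst]
  have hrange : Set.range s₁.base ⊆ Set.range (π ⁻¹ᵁ W).ι.base := by
    rintro _ ⟨w, rfl⟩
    rw [Scheme.Opens.range_ι]
    show π.base (s₁.base w) ∈ W
    rw [← Scheme.Hom.comp_apply, hs₁π]
    exact w.2
  have hs : IsOpenImmersion.lift (π ⁻¹ᵁ W).ι s₁ hrange ≫ (π ∣_ W) = 𝟙 _ := by
    rw [← cancel_mono W.ι, Category.assoc, morphismRestrict_ι, ← Category.assoc,
      IsOpenImmersion.lift_fac, hs₁π, Category.id_comp]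
  exact isIso_of_comp_eq_id_of_injective (π ∣_ W) hinj _ hs

/-! ## The resolution over the perfect closure (copy of `exists_resolution_perfectClosure`) -/

section PerfectClosureBase

variable (p : ℕ) [Fact p.Prime]
variable {k : Type} [Field k] [CharP k p] {X : Scheme.{0}} (f : X ⟶ Spec (.of k))

/-- **The resolution over the perfect closure.** Under Theorem A's hypotheses at the prime `p`
(the two conjuncts of the thesis), for an integral separated `k`-scheme `X` of finite type,
`char k = p`, the reduced base change `X^∞ = (Spec K ×_k X)_red` to the perfect closure
`K = k^{p^{-∞}}` is integral and admits a proper birational `π : R → X^∞` with `R` regular and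
integral. [folklore] -/
theorem exists_resolution_perfectClosure_ofPerfect (hp : p.Prime)
    (hPI : ∀ (k : Type) [Field k] [CharP k p] [PerfectField k] (X : Scheme.{0}) (f : X ⟶ Spec (.of k)),
      IsSeparated f → LocallyOfFiniteType f → QuasiCompact f → IsIntegral X →
      ∃ (X' : Scheme.{0}) (g : X' ⟶ X), IsProper g ∧ IsIntegral X' ∧ Scheme.IsRegular X' ∧
        Function.Surjective g.base ∧ ∃ U : X.Opens, Dense (U : Set X) ∧ IsFinite (g ∣_ U) ∧
        UniversallyInjective (g ∣_ U))
    (hPC : ∀ (k : Type) [Field k] [CharP k p] (Y X : Scheme.{0}) (f : Y ⟶ Spec (.of k))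
      (g : X ⟶ Y), IsSeparated f → LocallyOfFiniteType f → QuasiCompact f → IsIntegral Y →
      Scheme.IsRegular Y → IsIntegral X → IsFinite g → UniversallyInjective g →
      Function.Surjective g.base → Scheme.HasResolution X)
    [IsSeparated f] [LocallyOfFiniteType f] [QuasiCompact f] [IsIntegral X] :
    IsIntegral (vanishingIdeal (⊤ : Closeds
        ↑(pullback (Spec.map (CommRingCat.ofHom (PerfectClosure.of k p))) f))).subscheme ∧
    ∃ (R : Scheme.{0}) (π : R ⟶ (vanishingIdeal (⊤ : Closeds
        ↑(pullback (Spec.map (CommRingCat.ofHom (PerfectClosure.of k p))) f))).subscheme),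
      IsProper π ∧ IsBirational π ∧ Scheme.IsRegular R ∧ IsIntegral R := by
  haveI := irreducibleSpace_pullback_perfectClosure p f
  set XK := pullback (Spec.map (CommRingCat.ofHom (PerfectClosure.of k p))) f with hXK
  haveI hint : IsIntegral (vanishingIdeal (⊤ : Closeds ↑XK)).subscheme :=
    isIntegral_subscheme_vanishingIdeal_top
  refine ⟨hint, ?_⟩
  set ι₀ := (vanishingIdeal (⊤ : Closeds ↑XK)).subschemeι with hι₀
  let fK : (vanishingIdeal (⊤ : Closeds ↑XK)).subscheme ⟶ Spec (.of (PerfectClosure k p)) :=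
    ι₀ ≫ pullback.fst _ f
  haveI : IsSeparated fK := inferInstance
  haveI : LocallyOfFiniteType fK := inferInstance
  haveI : QuasiCompact fK := inferInstance
  obtain ⟨R, π, hπ⟩ := hasResolution_of_pialtPerfect_picover_perfectField p hp hPI hPC
    (PerfectClosure k p) _ fK
  haveI := hπ.isProper
  haveI : IrreducibleSpace R := hπ.isBirational.irreducibleSpace
  haveI : IsReduced R := hπ.isRegular.isReduced
  exact ⟨R, π, hπ.isProper, hπ.isBirational, hπ.isRegular,
    isIntegral_of_irreducibleSpace_of_isReduced R⟩

end PerfectClosureBase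

/-! ## A regular model at a full Frobenius level (copy of `exists_level_model`) -/

-- as in Mathlib's pullback API for schemes
set_option backward.isDefEq.respectTransparency false in
/-- **A regular model at a full Frobenius level** (see the module docstring). [folklore] -/
theorem exists_level_model_ofPerfect (p : ℕ) [Fact p.Prime]
    (hPI : ∀ (k : Type) [Field k] [CharP k p] [PerfectField k] (X : Scheme.{0}) (f : X ⟶ Spec (.of k)),
      IsSeparated f → LocallyOfFiniteType f → QuasiCompact f → IsIntegral X →
      ∃ (X' : Scheme.{0}) (g : X' ⟶ X), IsProper g ∧ IsIntegral X' ∧ Scheme.IsRegular X' ∧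
        Function.Surjective g.base ∧ ∃ U : X.Opens, Dense (U : Set X) ∧ IsFinite (g ∣_ U) ∧
        UniversallyInjective (g ∣_ U))
    (hPC : ∀ (k : Type) [Field k] [CharP k p] (Y X : Scheme.{0}) (f : Y ⟶ Spec (.of k))
      (g : X ⟶ Y), IsSeparated f → LocallyOfFiniteType f → QuasiCompact f → IsIntegral Y →
      Scheme.IsRegular Y → IsIntegral X → IsFinite g → UniversallyInjective g →
      Function.Surjective g.base → Scheme.HasResolution X)
    {k : Type} [Field k] [CharP k p] {X : Scheme.{0}} (f : X ⟶ Spec (.of k))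
    [IsSeparated f] [LocallyOfFiniteType f] [QuasiCompact f] [IsIntegral X] :
    ∃ (n : ℕ) (Rn : Scheme.{0}) (ρn : Rn ⟶ pullback (Spec.map (CommRingCat.ofHom
        ((PerfectClosure.of k p).codRestrict
          (Subfield.comap (iterateFrobenius (PerfectClosure k p) p n) (PerfectClosure.of k p).fieldRange)
          (of_mem_level p k n)))) f),
      IsIntegral Rn ∧ Scheme.IsRegular Rn ∧ IsProper ρn ∧ Surjective ρn ∧ IsBirational ρn.toImage := by
  -- ### the resolution over the perfect closure
  have hres := exists_resolution_perfectClosure_ofPerfect p f Fact.out hPI hPC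
  obtain ⟨hXinf, hres2⟩ := hres
  obtain ⟨R, π₀, hπP, hπB, hRreg, hRint⟩ := hres2
  haveI := hXinf
  haveI := hπP
  haveI := hRint
  -- ### embedding and descent to a full level
  obtain ⟨Q, prX, m₀, hQqc, hQsep, hQlft, hm, hprX, hm1, hm2⟩ := exists_closedImmersion_baseChange p f
    (π₀ ≫ (vanishingIdeal (⊤ : Closeds
      ↑(pullback (Spec.map (CommRingCat.ofHom (PerfectClosure.of k p))) f))).subschemeι)
  haveI := hQqc; haveI := hQsep; haveI := hQlft; haveI := hm
  obtain ⟨n, Rn, ιRn₀, e, hιRn, SqRm₀, he₀⟩ := exists_level_model_of_closedImmersion p Q m₀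
  haveI := hιRn
  -- ### notation: aliases with explicit types (all definitional)
  let σK : CommRingCat.of k ⟶ CommRingCat.of (PerfectClosure k p) :=
    CommRingCat.ofHom (PerfectClosure.of k p)
  let XK := pullback (Spec.map σK) f
  let Xinf := (vanishingIdeal (⊤ : Closeds ↑XK)).subscheme
  let ι₀ : Xinf ⟶ XK := (vanishingIdeal (⊤ : Closeds ↑XK)).subschemeι
  let π : R ⟶ Xinf := π₀
  haveI : IsProper π := hπP
  have hπB' : IsBirational π := hπB
  haveI : IsDominant π := hπB'.isDominant
  haveI : IsSchemeTheoreticallyDominant π := .of_isDominant π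
  let ρ : R ⟶ XK := π ≫ ι₀
  haveI : IsProper ρ := inferInstanceAs (IsProper (π ≫ ι₀))
  let L := Subfield.comap (iterateFrobenius (PerfectClosure k p) p n) (PerfectClosure.of k p).fieldRange
  let ιn : k →+* L := (PerfectClosure.of k p).codRestrict L (of_mem_level p k n)
  let ιL : L →+* PerfectClosure k p := L.subtype
  have hιLιn : σK = CommRingCat.ofHom ιn ≫ CommRingCat.ofHom ιL := by ext y; rfl
  let Xn := pullback (Spec.map (CommRingCat.ofHom ιn)) f
  let Qn := pullback (Spec.map (CommRingCat.ofHom ιn)) Q.hom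
  let m : R ⟶ pullback (Spec.map σK) Q.hom := m₀
  haveI : IsClosedImmersion m := hm
  let ιRn : Rn ⟶ Qn := ιRn₀
  haveI : IsClosedImmersion ιRn := hιRn
  have SqRm : IsPullback (m ≫ pullback.fst _ _) e (Spec.map (CommRingCat.ofHom ιL))
      (ιRn ≫ pullback.fst _ _) := SqRm₀
  have he : e ≫ ιRn ≫ pullback.snd _ _ = m ≫ pullback.snd _ _ := he₀
  have hm1' : m ≫ pullback.fst _ _ = ρ ≫ pullback.fst _ _ := hm1
  have hm2' : m ≫ pullback.snd _ _ ≫ prX = ρ ≫ pullback.snd _ _ := hm2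
  -- ### the level objects
  let qX : Qn ⟶ Xn := pullback.map _ _ _ _ (𝟙 _) prX (𝟙 _) (by simp) (by rw [Category.comp_id, hprX])
  let ρn : Rn ⟶ Xn := ιRn ≫ qX
  have hρnfst : ρn ≫ pullback.fst _ _ = ιRn ≫ pullback.fst _ _ := by simp [ρn, qX]
  have hρnsnd : ρn ≫ pullback.snd _ _ = ιRn ≫ pullback.snd _ _ ≫ prX := by simp [ρn, qX]
  -- `XK'' = Spec K ×_{k_n} Xn ≅ XK`
  let XK'' := pullback (Spec.map (CommRingCat.ofHom ιL)) (pullback.fst (Spec.map (CommRingCat.ofHom ιn)) f)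
  let snd'' : XK'' ⟶ Xn := pullback.snd _ _
  haveI hflatL : Flat (Spec.map (CommRingCat.ofHom ιL)) := flat_specMap_of_field ιL
  haveI hsurjL : Surjective (Spec.map (CommRingCat.ofHom ιL)) := surjective_specMap_field ιL
  have hradL : ∀ x : PerfectClosure k p, ∃ (n : ℕ) (y : L), ιL y = x ^ p ^ n := fun x => by
    obtain ⟨n', y, hy⟩ := perfectClosure_pow_mem p x
    exact ⟨n', ⟨PerfectClosure.of k p y, of_mem_level p k n y⟩, hy⟩
  haveI huiL : UniversallyInjective (Spec.map (CommRingCat.ofHom ιL)) :=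
    universallyInjective_specMap_field_of_pow_mem ιL p hradL
  haveI hintL : IsIntegralHom (Spec.map (CommRingCat.ofHom ιL)) :=
    isIntegralHom_specMap_of_pow_mem ιL p hradL
  haveI : Flat snd'' := MorphismProperty.pullback_snd _ _ hflatL
  haveI : Surjective snd'' := MorphismProperty.pullback_snd _ _ hsurjL
  haveI : UniversallyInjective snd'' := universallyInjective_pullback_snd _ _
  haveI : UniversallyClosed snd'' := MorphismProperty.pullback_snd _ _ inferInstance
  haveI : QuasiCompact snd'' := inferInstance
  have hcondXK : pullback.snd (Spec.map σK) f ≫ f = pullback.fst _ _ ≫ Spec.map σK :=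
    pullback.condition.symm
  have hcondXn : pullback.snd (Spec.map (CommRingCat.ofHom ιn)) f ≫ f =
      pullback.fst _ _ ≫ Spec.map (CommRingCat.ofHom ιn) := pullback.condition.symm
  have hcond'' : snd'' ≫ pullback.fst _ _ = pullback.fst _ _ ≫ Spec.map (CommRingCat.ofHom ιL) :=
    pullback.condition.symm
  let eXK : XK'' ⟶ XK := pullback.lift (pullback.fst _ _) (snd'' ≫ pullback.snd _ _) (by
    rw [Category.assoc, hcondXn, ← Category.assoc, hcond'', Category.assoc, ← Spec.map_comp, ← hιLιn])
  let dXn : XK ⟶ Xn := pullback.lift (pullback.fst _ _ ≫ Spec.map (CommRingCat.ofHom ιL))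
    (pullback.snd _ _) (by rw [Category.assoc, ← Spec.map_comp, ← hιLιn, hcondXK])
  let dXK : XK ⟶ XK'' := pullback.lift (pullback.fst _ _) dXn (by simp [dXn])
  have hed : eXK ≫ dXK = 𝟙 _ := by
    apply pullback.hom_ext
    · simp [eXK, dXK]
    · apply pullback.hom_ext
      · simpa [eXK, dXK, dXn] using hcond''.symm
      · simp [eXK, dXK, dXn, snd'']
  have hde : dXK ≫ eXK = 𝟙 _ := by
    apply pullback.hom_ext
    · simp [eXK, dXK]
    · simp [eXK, dXK, dXn, snd'']
  haveI : IsIso eXK := ⟨dXK, hed, hde⟩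
  haveI : IsIso dXK := ⟨eXK, hde, hed⟩
  -- ### `ρK : R → XK''` and the key cartesian square `R = XK'' ×_{Xn} Rn`
  let gR := m ≫ pullback.fst (Spec.map σK) Q.hom
  let ρK : R ⟶ XK'' := pullback.lift gR (e ≫ ρn)
    (by rw [Category.assoc e ρn, hρnfst]; exact SqRm.w)
  have SqX : IsPullback e ρK ρn snd'' := by
    refine IsPullback.of_bot (v₂₁ := pullback.fst _ _) (v₂₂ := pullback.fst _ _)
      (h₃₁ := Spec.map (CommRingCat.ofHom ιL)) ?_ (pullback.lift_snd _ _ _).symm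
      (IsPullback.of_hasPullback _ _).flip
    rw [pullback.lift_fst, hρnfst]
    exact SqRm.flip
  have hρKe : ρK ≫ eXK = ρ := by
    apply pullback.hom_ext
    · simp only [ρK, eXK, gR, Category.assoc, pullback.lift_fst]
      rw [hm1']
    · simp only [ρK, eXK, snd'', Category.assoc, pullback.lift_snd, pullback.lift_snd_assoc]
      rw [hρnsnd, reassoc_of% he, hm2']
  have hρK : ρK = ρ ≫ dXK := by
    rw [← hρKe, Category.assoc, hed, Category.comp_id]
  haveI : UniversallyClosed ρK := by rw [hρK]; infer_instance
  haveI : QuasiCompact ρK := by rw [hρK]; infer_instance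
  -- ### properties of `R_n` and `ρ_n`
  haveI : Flat e := MorphismProperty.of_isPullback (P := @Flat) SqRm hflatL
  haveI : Surjective e := MorphismProperty.of_isPullback (P := @Surjective) SqRm hsurjL
  haveI : IsLocallyNoetherian Rn :=
    LocallyOfFiniteType.isLocallyNoetherian (ιRn ≫ pullback.fst (Spec.map (CommRingCat.ofHom ιn)) Q.hom)
  have hRnreg : Scheme.IsRegular Rn := isRegular_of_flat_surjective e hRreg
  haveI hRnint : IsIntegral Rn := isIntegral_of_flat_surjective e
  have hQ : (@Surjective ⊓ @Flat ⊓ @QuasiCompact : MorphismProperty Scheme) snd'' :=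
    ⟨⟨inferInstance, inferInstance⟩, inferInstance⟩
  haveI : UniversallyClosed ρn :=
    MorphismProperty.of_isPullback_of_descendsAlong (P := @UniversallyClosed) SqX.flip hQ inferInstance
  haveI : IsSeparated (qX ≫ pullback.fst _ _) := by
    have : qX ≫ pullback.fst _ _ = pullback.fst _ _ := by simp [qX]
    rw [this]; infer_instance
  haveI : IsSeparated qX := IsSeparated.of_comp qX (pullback.fst _ _)
  haveI : IsSeparated ρn := inferInstanceAs (IsSeparated (ιRn ≫ qX))
  haveI : LocallyOfFiniteType (ρn ≫ pullback.fst _ _) := by rw [hρnfst]; infer_instance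
  haveI : LocallyOfFiniteType ρn := locallyOfFiniteType_of_comp ρn (pullback.fst _ _)
  haveI hρnP : IsProper ρn := ⟨⟩
  have hρnsurj : Surjective ρn := by
    haveI : Surjective π := surjective_of_isDominant_of_universallyClosed π
    haveI : Surjective ρ := inferInstanceAs (Surjective (π ≫ ι₀))
    haveI : Surjective (ρK ≫ snd'') := by rw [hρK]; infer_instance
    haveI : Surjective (e ≫ ρn) := by rw [SqX.w]; infer_instance
    exact Surjective.of_comp e ρn
  refine ⟨n, Rn, ρn, hRnint, hRnreg, hρnP, hρnsurj, ?_⟩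
  -- ### birationality of `R_n → S_n` (`S_n` the scheme-theoretic image)
  let Sn := ρn.image
  let jn : Sn ⟶ Xn := ρn.imageι
  let πn : Rn ⟶ Sn := ρn.toImage
  haveI : IsSchemeTheoreticallyDominant πn := ChowLemmaProof.isSchemeTheoreticallyDominant_toImage ρn
  -- `T = S_n ×_{X_n} XK''` and `R = R_n ×_{S_n} T`
  let T := pullback jn snd''
  let fstT : T ⟶ Sn := pullback.fst jn snd''
  let sndT : T ⟶ XK'' := pullback.snd jn snd''
  haveI : Flat fstT := MorphismProperty.pullback_fst _ _ inferInstance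
  haveI : Surjective fstT := MorphismProperty.pullback_fst _ _ inferInstance
  haveI : QuasiCompact fstT := MorphismProperty.pullback_fst _ _ inferInstance
  haveI : UniversallyClosed fstT := MorphismProperty.pullback_fst _ _ inferInstance
  haveI : UniversallyInjective fstT :=
    MorphismProperty.pullback_fst (P := @UniversallyInjective) _ _ inferInstance
  let uR : R ⟶ T := pullback.lift (e ≫ πn) ρK (by rw [Category.assoc, Scheme.Hom.toImage_imageι]; exact SqX.w)
  have SqT : IsPullback uR e fstT πn :=
    IsPullback.of_right (h₁₂ := sndT) (v₁₃ := snd'') (h₂₂ := jn)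
      (by rw [pullback.lift_snd, Scheme.Hom.toImage_imageι]; exact SqX.flip)
      (pullback.lift_fst _ _ _) (IsPullback.of_hasPullback jn snd'').flip
  haveI : IsSchemeTheoreticallyDominant uR := IsSchemeTheoreticallyDominant.of_isPullback SqT.flip
  haveI : QuasiCompact (uR ≫ sndT) := by rw [pullback.lift_snd]; infer_instance
  haveI : QuasiCompact uR := QuasiCompact.of_comp uR sndT
  haveI : IsReduced T := IsSchemeTheoreticallyDominant.isReduced uR
  -- `X^∞ ≅ T`
  let ι₀K : Xinf ⟶ XK'' := ι₀ ≫ dXK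
  haveI : IsClosedImmersion ι₀K := inferInstance
  have hfac : π ≫ ι₀K ≫ snd'' = e ≫ ρn := by
    rw [SqX.w, hρK]; simp [ι₀K, ρ]
  have hker : ρn.ker ≤ (ι₀K ≫ snd'').ker := by
    intro U s hs
    rw [Scheme.Hom.ker_apply] at hs ⊢
    apply π.app_injective
    rw [map_zero]
    change (π ≫ ι₀K ≫ snd'').app U s = 0
    rw [hfac]
    change e.app _ (ρn.app U s) = 0
    rw [RingHom.mem_ker.mp hs, map_zero]
  let v : Xinf ⟶ Sn := (ι₀K ≫ snd'').toImage ≫ inclusion hker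
  have hv : v ≫ jn = ι₀K ≫ snd'' := by
    simp only [v, jn, Category.assoc, Scheme.Hom.imageι, inclusion_subschemeι, Scheme.Hom.toImage_imageι]
  let uT : Xinf ⟶ T := pullback.lift v ι₀K hv
  haveI : IsClosedImmersion (uT ≫ sndT) := by rw [pullback.lift_snd]; infer_instance
  haveI : IsClosedImmersion uT := IsClosedImmersion.of_comp uT sndT
  haveI : Surjective uT := ⟨fun tt => by
    obtain ⟨x, hx⟩ := (inferInstance : Surjective ι₀K).1 (sndT.base tt)
    refine ⟨x, sndT.isClosedEmbedding.injective ?_⟩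
    rw [← Scheme.Hom.comp_apply, pullback.lift_snd, hx]⟩
  haveI : IsIso uT := isIso_of_isClosedImmersion_of_surjective uT
  have huR : uR = π ≫ uT := by
    apply pullback.hom_ext
    · rw [← cancel_mono jn]
      simp only [uR, uT, πn, jn, Category.assoc, pullback.lift_fst, hv, Scheme.Hom.toImage_imageι]
      exact hfac.symm
    · simp only [uR, uT, Category.assoc, pullback.lift_snd, hρK]
      rfl
  have SqS : IsPullback π e v πn := by
    refine IsPullback.of_iso SqT (Iso.refl _) (asIso uT).symm (Iso.refl _) (Iso.refl _) ?_ ?_ ?_ ?_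
    · rw [Iso.refl_hom, Category.id_comp, huR, Iso.symm_hom, asIso_inv, Category.assoc,
        IsIso.hom_inv_id, Category.comp_id]
    · simp
    · rw [Iso.refl_hom, Category.comp_id, Iso.symm_hom, asIso_inv, IsIso.eq_inv_comp]
      exact pullback.lift_fst _ _ _
    · simp
  -- `v` is faithfully flat and a homeomorphism
  have hvT : v = uT ≫ fstT := (pullback.lift_fst _ _ _).symm
  haveI : Flat v := by rw [hvT]; infer_instance
  haveI : Surjective v := by rw [hvT]; infer_instance
  haveI : QuasiCompact v := by rw [hvT]; infer_instance
  have hvh : IsHomeomorph v.base := by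
    have h1 : IsHomeomorph fstT.base :=
      isHomeomorph_of_universallyClosed_of_universallyInjective fstT
    have h2 : IsHomeomorph uT.base := (Scheme.homeoOfIso (asIso uT)).isHomeomorph
    rw [hvT, Scheme.Hom.comp_base]
    exact h1.comp h2
  -- the dense open
  obtain ⟨U, hU, -, hisoU⟩ := hπB'
  let Un : Sn.Opens := ⟨v.base '' (U : Set Xinf), hvh.isOpenMap _ U.2⟩
  have hUeq : v ⁻¹ᵁ Un = U := Opens.ext (Set.preimage_image_eq _ hvh.injective)
  haveI : IrreducibleSpace T := irreducibleSpace_of_surjective uT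
  haveI : IrreducibleSpace Sn := irreducibleSpace_of_surjective fstT
  obtain ⟨u₀, hu₀⟩ := hU.nonempty
  haveI : Surjective πn := surjective_toImage_of_universallyClosed ρn
  refine ⟨Un, Un.2.dense ⟨v.base u₀, u₀, hu₀, rfl⟩, (πn ⁻¹ᵁ Un).2.dense ?_, ?_⟩
  · obtain ⟨r, hr⟩ := πn.surjective (v.base u₀)
    exact ⟨r, show πn.base r ∈ Un from hr ▸ ⟨u₀, hu₀, rfl⟩⟩
  obtain ⟨eW, -, SqW⟩ := IsPullback.exists_restrict SqS Un
  have hisoU' : (MorphismProperty.isomorphisms Scheme) (π ∣_ (v ⁻¹ᵁ Un)) :=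
    ((MorphismProperty.isomorphisms Scheme).arrow_mk_iso_iff (morphismRestrictEq π hUeq)).mpr
      ((MorphismProperty.isomorphisms.iff _).mpr hisoU)
  have hQ' : (@Surjective ⊓ @Flat ⊓ @QuasiCompact : MorphismProperty Scheme) (v ∣_ Un) :=
    ⟨⟨IsZariskiLocalAtTarget.restrict ‹Surjective v› Un, inferInstance⟩, inferInstance⟩
  exact (MorphismProperty.isomorphisms.iff _).mp
    (MorphismProperty.of_isPullback_of_descendsAlong (P := MorphismProperty.isomorphisms Scheme)
      SqW hQ' hisoU')

/-! ## Theorem B (copy of `hasResolution_of_thesis`) -/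


-- as in Mathlib's pullback API for schemes
set_option backward.isDefEq.respectTransparency false in
/-- **Theorem B.** For a prime `p`, (PIAlt_p) and (PICover_p) imply resolution of singularities
of every integral separated scheme of finite type over every field of characteristic `p`
(see the module docstring). [folklore] -/
theorem hasResolution_of_thesis_ofPerfect (p : ℕ) [Fact p.Prime]
    (hPI : ∀ (k : Type) [Field k] [CharP k p] [PerfectField k] (X : Scheme.{0}) (f : X ⟶ Spec (.of k)),
      IsSeparated f → LocallyOfFiniteType f → QuasiCompact f → IsIntegral X →
      ∃ (X' : Scheme.{0}) (g : X' ⟶ X), IsProper g ∧ IsIntegral X' ∧ Scheme.IsRegular X' ∧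
        Function.Surjective g.base ∧ ∃ U : X.Opens, Dense (U : Set X) ∧ IsFinite (g ∣_ U) ∧
        UniversallyInjective (g ∣_ U))
    (hPC : ∀ (k : Type) [Field k] [CharP k p] (Y X : Scheme.{0}) (f : Y ⟶ Spec (.of k))
      (g : X ⟶ Y), IsSeparated f → LocallyOfFiniteType f → QuasiCompact f → IsIntegral Y →
      Scheme.IsRegular Y → IsIntegral X → IsFinite g → UniversallyInjective g →
      Function.Surjective g.base → Scheme.HasResolution X)
    {k : Type} [Field k] [CharP k p] {X : Scheme.{0}} (f : X ⟶ Spec (.of k))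
    [IsSeparated f] [LocallyOfFiniteType f] [QuasiCompact f] [IsIntegral X] :
    Scheme.HasResolution X := by
  obtain ⟨n, Rn, ρn, hRnint, hRnreg, hρnP, hρnsurj, hbir⟩ := exists_level_model_ofPerfect p hPI hPC f
  haveI := hRnint; haveI := hρnP; haveI := hρnsurj
  -- the level
  let L := Subfield.comap (iterateFrobenius (PerfectClosure k p) p n) (PerfectClosure.of k p).fieldRange
  let ιn : k →+* L := (PerfectClosure.of k p).codRestrict L (of_mem_level p k n)
  let Xn := pullback (Spec.map (CommRingCat.ofHom ιn)) f
  let ρ : Rn ⟶ Xn := ρn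
  haveI : IsProper ρ := hρnP
  haveI : Surjective ρ := hρnsurj
  have hbir' : IsBirational ρ.toImage := hbir
  haveI : CharP L p := (RingHom.charP_iff_charP L.subtype p).mpr inferInstance
  -- the relative Frobenius `ψ : X → X_n`, factored through the image `S_n` of `ρ`
  have hpX : (p : Γ(X, ⊤)) = 0 := natCast_appTop_eq_zero p f
  obtain ⟨ψ₀, hψfin, hψui, hψsurj, -⟩ := exists_relFrobenius p f n (add_pow_sections p hpX n)
  let ψ : X ⟶ Xn := ψ₀
  haveI : IsFinite ψ := hψfin
  haveI : UniversallyInjective ψ := hψui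
  haveI : Surjective ψ := hψsurj
  let Sn := ρ.image
  let jn : Sn ⟶ Xn := ρ.imageι
  let πn : Rn ⟶ Sn := ρ.toImage
  haveI : Surjective πn := surjective_toImage_of_universallyClosed ρ
  have hker : ρ.ker ≤ ψ.ker := by
    refine le_trans ?_ (vanishingIdeal_top_le_ker ψ)
    rw [← le_support_iff_le_vanishingIdeal, top_le_iff, ← SetLike.coe_set_eq, Scheme.Hom.support_ker,
      ρ.surjective.range_eq, closure_univ]
    rfl
  let ψ' : X ⟶ Sn := ψ.toImage ≫ inclusion hker
  have hψ' : ψ' ≫ jn = ψ := by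
    simp only [ψ', jn, Category.assoc, Scheme.Hom.imageι, inclusion_subschemeι, Scheme.Hom.toImage_imageι]
  haveI : IsFinite (ψ' ≫ jn) := by rw [hψ']; infer_instance
  haveI : IsFinite ψ' := IsFinite.of_comp ψ' jn
  haveI : UniversallyInjective (ψ' ≫ jn) := by rw [hψ']; infer_instance
  haveI : UniversallyInjective ψ' := universallyInjective_of_comp ψ' jn
  haveI : Surjective ψ' := ⟨fun y => by
    obtain ⟨x, hx⟩ := ψ.surjective (jn.base y)
    exact ⟨x, jn.isClosedEmbedding.injective (by rw [← Scheme.Hom.comp_apply, hψ', hx])⟩⟩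
  -- the reduced fibre product `Z = (X ×_{S_n} R_n)_red` and its resolution from (PICover)
  let W := pullback ψ' πn
  let Z := (vanishingIdeal (⊤ : Closeds ↑W)).subscheme
  let ιW : Z ⟶ W := (vanishingIdeal (⊤ : Closeds ↑W)).subschemeι
  haveI : IsIntegral Z := isIntegral_reduced_pullback ψ' πn
  let fn : Rn ⟶ Spec (.of L) := ρ ≫ pullback.fst _ _
  haveI : IsSeparated fn := inferInstance
  haveI : LocallyOfFiniteType fn := inferInstance
  haveI : QuasiCompact fn := inferInstance
  have hZ : Scheme.HasResolution Z :=
    hPC L Rn Z fn (ιW ≫ pullback.snd ψ' πn) inferInstance inferInstance inferInstance hRnint hRnreg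
      inferInstance (isFinite_reduced_pullback_snd ψ' πn)
      (universallyInjective_reduced_pullback_snd ψ' πn) (surjective_reduced_pullback_snd ψ' πn).1
  -- `τ : Z → X` is proper and birational
  haveI : IsSeparated (ρ.toImage ≫ ρ.imageι) := by rw [Scheme.Hom.toImage_imageι]; infer_instance
  haveI : IsSeparated πn := IsSeparated.of_comp ρ.toImage ρ.imageι
  haveI : LocallyOfFiniteType (ρ.toImage ≫ ρ.imageι) := by
    rw [Scheme.Hom.toImage_imageι]; infer_instance
  haveI : LocallyOfFiniteType πn := locallyOfFiniteType_of_comp ρ.toImage ρ.imageι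
  haveI : UniversallyClosed πn := inferInstanceAs (UniversallyClosed ρ.toImage)
  haveI : IsProper πn := ⟨⟩
  let τ : Z ⟶ X := ιW ≫ pullback.fst ψ' πn
  haveI : IsProper τ := inferInstanceAs (IsProper (ιW ≫ pullback.fst ψ' πn))
  refine Scheme.HasResolution.of_isBirational τ ?_ hZ
  obtain ⟨U, hU, -, hiso⟩ := hbir'
  haveI := hiso
  haveI : Nonempty Sn := ⟨πn.base (Classical.arbitrary Rn)⟩
  let V : X.Opens := ψ' ⁻¹ᵁ U
  obtain ⟨u₀, hu₀⟩ := hU.nonempty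
  obtain ⟨x₀, hx₀⟩ := ψ'.surjective u₀
  have hx₀V : x₀ ∈ V := show ψ'.base x₀ ∈ U by rw [hx₀]; exact hu₀
  haveI : Surjective (pullback.fst ψ' πn) := MorphismProperty.pullback_fst _ _ inferInstance
  haveI : Surjective τ := inferInstance
  refine ⟨V, V.2.dense ⟨x₀, hx₀V⟩, (τ ⁻¹ᵁ V).2.dense ?_, ?_⟩
  · obtain ⟨z, hz⟩ := τ.surjective x₀
    exact ⟨z, show τ.base z ∈ V by rw [hz]; exact hx₀V⟩
  -- over `V` the base change of `πn` is an isomorphism, and so is the reduction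
  obtain ⟨sndV, -, SqV⟩ := IsPullback.exists_restrict (IsPullback.of_hasPullback ψ' πn) U
  have hisoU : (MorphismProperty.isomorphisms Scheme) (πn ∣_ U) :=
    (MorphismProperty.isomorphisms.iff _).mpr hiso
  haveI hfstV : IsIso (pullback.fst ψ' πn ∣_ V) :=
    (MorphismProperty.isomorphisms.iff _).mp
      (MorphismProperty.of_isPullback (P := MorphismProperty.isomorphisms Scheme) SqV.flip hisoU)
  haveI : IsReduced (pullback.fst ψ' πn ⁻¹ᵁ V : Scheme.{0}) :=
    isReduced_of_isOpenImmersion (pullback.fst ψ' πn ∣_ V)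
  haveI : IsIso (ιW ∣_ (pullback.fst ψ' πn ⁻¹ᵁ V)) :=
    isIso_subschemeι_vanishingIdeal_top_morphismRestrict _
  rw [show τ ∣_ V = (ιW ∣_ (pullback.fst ψ' πn ⁻¹ᵁ V)) ≫ (pullback.fst ψ' πn ∣_ V) from
    morphismRestrict_comp _ _ _]
  infer_instance

/-! ## Consequences for the crux `WildQuotients.SummitReduction` -/

/-- **The perfect-field frame**: for a prime `p`, purely inseparable regular alterations of
integral varieties over PERFECT fields of characteristic `p` together with (PICover_p) over all
fields of characteristic `p` imply `ResolutionInChar p`. [folklore] -/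
theorem resolutionInChar_of_pialtPerfect_picover (p : ℕ) (hp : p.Prime)
    (hPI : ∀ (k : Type) [Field k] [CharP k p] [PerfectField k] (X : Scheme.{0}) (f : X ⟶ Spec (.of k)),
      IsSeparated f → LocallyOfFiniteType f → QuasiCompact f → IsIntegral X →
      ∃ (X' : Scheme.{0}) (g : X' ⟶ X), IsProper g ∧ IsIntegral X' ∧ Scheme.IsRegular X' ∧
        Function.Surjective g.base ∧ ∃ U : X.Opens, Dense (U : Set X) ∧ IsFinite (g ∣_ U) ∧
        UniversallyInjective (g ∣_ U))
    (hPC : ∀ (k : Type) [Field k] [CharP k p] (Y X : Scheme.{0}) (f : Y ⟶ Spec (.of k))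
      (g : X ⟶ Y), IsSeparated f → LocallyOfFiniteType f → QuasiCompact f → IsIntegral Y →
      Scheme.IsRegular Y → IsIntegral X → IsFinite g → UniversallyInjective g →
      Function.Surjective g.base → Scheme.HasResolution X) :
    ResolutionInChar.{0} p := by
  haveI : Fact p.Prime := ⟨hp⟩
  intro k _ _ X f hsep hlft hqc hred
  exact Summit.ResolutionOfSingularities.ResolutionOfSingularities.Theses.PAlteration.DescentReducedToIntegral_holds
    k (fun Y g h1 h2 h3 h4 => by
      haveI := h1; haveI := h2; haveI := h3; haveI := h4
      exact hasResolution_of_thesis_ofPerfect p hPI hPC g) X f hsep hlft hqc hred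

/-- **The squeezed reduction closes the crux**: if for every prime `p` the perfect-field instances
of `WildQuotientResolution` give purely inseparable regular alterations of integral varieties over
perfect fields of characteristic `p` (de Jong 1997 Thm 5.13/Cor 5.15 + quotient + WQ, over perfect
fields only), then `WildQuotients.SummitReduction` holds. [folklore] -/
theorem summitReduction_of_galoisReductionPerfect
    (hG : ∀ p : ℕ, p.Prime →
      (∀ (k : Type) [Field k] [CharP k p] [PerfectField k] (X' X₁ : AlgebraicGeometry.Scheme.{0})
        (f : X₁ ⟶ AlgebraicGeometry.Spec (.of k)) (q : X' ⟶ X₁) (G : Type) [Group G] [Finite G]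
        (ρ : G →* CategoryTheory.Aut X'),
        AlgebraicGeometry.IsSeparated f → AlgebraicGeometry.LocallyOfFiniteType f →
        AlgebraicGeometry.QuasiCompact f → AlgebraicGeometry.IsIntegral X₁ →
        AlgebraicGeometry.IsIntegral X' → Literature.AlgebraicGeometry.Resolution.Scheme.IsRegular X' →
        AlgebraicGeometry.IsFinite q → Function.Surjective q.base →
        (∃ U : X₁.Opens, Dense (U : Set X₁) ∧ AlgebraicGeometry.Etale (AlgebraicGeometry.morphismRestrict q U)) →
        (∀ g : G, CategoryTheory.CategoryStruct.comp (ρ g).hom q = q) →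
        (∀ x y : X', q.base x = q.base y → ∃ g : G, (ρ g).hom.base x = y) →
        Literature.AlgebraicGeometry.Resolution.Scheme.HasResolution X₁) →
      ∀ (k : Type) [Field k] [CharP k p] [PerfectField k] (X : Scheme.{0}) (f : X ⟶ Spec (.of k)),
        IsSeparated f → LocallyOfFiniteType f → QuasiCompact f → IsIntegral X →
        ∃ (X' : Scheme.{0}) (g : X' ⟶ X), IsProper g ∧ IsIntegral X' ∧ Scheme.IsRegular X' ∧
          Function.Surjective g.base ∧ ∃ U : X.Opens, Dense (U : Set X) ∧ IsFinite (g ∣_ U) ∧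
          UniversallyInjective (g ∣_ U)) :
    Summit.ResolutionOfSingularities.ResolutionOfSingularities.Theses.WildQuotients.SummitReduction := by
  intro p hp hWQ hPC
  exact resolutionInChar_of_pialtPerfect_picover p hp
    (hG p hp (fun k _ _ _ X' X₁ f q G _ _ ρ => hWQ k X' X₁ f q G ρ)) hPC

end Summit.ResolutionOfSingularities.ResolutionOfSingularities.Theorems

end
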